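import Mathlib

/-!
# A continuous character of a profinite group into `ℂˣ` has finite order (T3.3 / T3.5)

Blind re-derivation cell `pub-hodge-repro`, Tier 3, seat `t3-p2` (prover-pub-hodge-repro-t3-p2-g8-0), sub-goal T3.3 of
`route/TIER3.md` (§7 «N2 IS FREE»: the forced fourth corner character `μ_{i₄,cs} := μ_{i₁,s} μ_{i₂,s} μ_{i₃,cs}⁻¹`
«differs from any other admissible choice by a finite-order anticyclotomic character (trivial infinity type + trivial on
`𝔸_{F′}^×` ⇒ a character of a profinite group)», `proofs/t3-p2/R3R4-INSTANTIATION.md` §4.4bis; the route's twist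
classes `Ξ` are the finite-order characters).  Target tree path `lean/Summits/Ventures/HodgeRepro/Tier3ProfiniteCharacter.lean`;
`import Mathlib` only.

The elementary core, on the kernel — a continuous homomorphism from a compact totally disconnected group to `ℂˣ`
has finite image:

* `norm_sq_sub_one_ge`, `norm_pow_two_pow_sub_one_ge` — inside the ball `‖z − 1‖ < 1/2` squaring multiplies the distance
  to `1` by at least `3/2` (`z² − 1 = (z − 1)(z + 1)`, `‖z + 1‖ ≥ 2 − ‖z − 1‖`), so the iterated squares of `z ≠ 1`
  leave the ball;
* `eq_bot_of_subset_ball` — **`ℂˣ` has no small subgroups**: a subgroup of `ℂˣ` contained in that ball is trivial;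
* `exists_openNormalSubgroup_le_ker` — a continuous `χ : G →* ℂˣ` on a compact totally disconnected group `G` kills an
  open normal subgroup (Mathlib's `ProfiniteGrp.exist_openNormalSubgroup_sub_open_nhds_of_one` on the preimage of
  the ball, whose image is a subgroup inside the ball);
* `finite_range_of_continuous` — hence `χ` has finite range; `isOpen_ker_of_continuous` / `finiteIndex_ker_of_continuous`
  — its kernel is open of finite index; `exists_pow_eq_one` — `χ ^ n = 1` for `n = Nat.card χ.range > 0`: a
  continuous character of a profinite group is of finite order; `exists_pow_mul_inv_eq_one` — two continuous
  characters differ by a character of finite order.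

Nothing here says anything about the status of the Hodge conjecture for CM abelian varieties, which is NOT proved.
-/

set_option autoImplicit false

namespace HodgeRepro

namespace T3.ProfiniteCharacter

/-- Inside the ball `‖z − 1‖ < 1/2` squaring multiplies the distance to `1` by at least `3/2`:
`z² − 1 = (z − 1)(z + 1)` and `‖z + 1‖ ≥ ‖2‖ − ‖z − 1‖ > 3/2`. -/
theorem norm_sq_sub_one_ge {z : ℂ} (hz : ‖z - 1‖ < 1 / 2) : 3 / 2 * ‖z - 1‖ ≤ ‖z ^ 2 - 1‖ := by
  have h1 : z ^ 2 - 1 = (z - 1) * (z + 1) := by ring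
  have h2 : (3 : ℝ) / 2 ≤ ‖z + 1‖ := by
    have h3 : ‖(2 : ℂ)‖ ≤ ‖z + 1‖ + ‖z - 1‖ := by
      have h4 : (2 : ℂ) = (z + 1) - (z - 1) := by ring
      rw [h4]
      exact norm_sub_le _ _
    rw [RCLike.norm_two] at h3
    linarith
  rw [h1, norm_mul]
  have h0 : 0 ≤ ‖z - 1‖ := norm_nonneg _
  nlinarith [h0, h2]

/-- The iterated squares of `z` drift away from `1` geometrically while they stay in the ball `‖· − 1‖ < 1/2`:
if `z, z², …, z^(2^n)` all lie in the ball then `‖z^(2^n) − 1‖ ≥ (3/2)^n ‖z − 1‖`. -/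
theorem norm_pow_two_pow_sub_one_ge {z : ℂ} (n : ℕ) (h : ∀ k ≤ n, ‖z ^ 2 ^ k - 1‖ < 1 / 2) :
    (3 / 2) ^ n * ‖z - 1‖ ≤ ‖z ^ 2 ^ n - 1‖ := by
  induction n with
  | zero => simp
  | succ n ih =>
    have ih' := ih (fun k hk => h k (Nat.le_succ_of_le hk))
    have hn := h n (Nat.le_succ n)
    have hsq := norm_sq_sub_one_ge hn
    have hrw : z ^ 2 ^ (n + 1) = (z ^ 2 ^ n) ^ 2 := by rw [pow_succ, pow_mul]
    rw [hrw, pow_succ]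
    calc (3 / 2 : ℝ) ^ n * (3 / 2) * ‖z - 1‖ = 3 / 2 * ((3 / 2) ^ n * ‖z - 1‖) := by ring
      _ ≤ 3 / 2 * ‖z ^ 2 ^ n - 1‖ := by gcongr
      _ ≤ ‖(z ^ 2 ^ n) ^ 2 - 1‖ := hsq

/-- **`ℂˣ` has no small subgroups.**  A subgroup of `ℂˣ` all of whose elements lie in the ball `‖z − 1‖ < 1/2` is
trivial: a non-trivial element's iterated squares stay in the subgroup but leave the ball
(`norm_pow_two_pow_sub_one_ge`). -/
theorem eq_bot_of_subset_ball (H : Subgroup ℂˣ) (hH : ∀ z ∈ H, ‖(z : ℂ) - 1‖ < 1 / 2) : H = ⊥ := by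
  rw [Subgroup.eq_bot_iff_forall]
  intro z hz
  by_contra hne
  have hpos : 0 < ‖(z : ℂ) - 1‖ := by
    rw [norm_pos_iff, sub_ne_zero]
    exact fun h => hne (Units.ext (h.trans Units.val_one.symm))
  obtain ⟨n, hn⟩ : ∃ n : ℕ, 1 / 2 ≤ (3 / 2 : ℝ) ^ n * ‖(z : ℂ) - 1‖ := by
    obtain ⟨n, hn⟩ := pow_unbounded_of_one_lt (1 / 2 / ‖(z : ℂ) - 1‖) (by norm_num : (1 : ℝ) < 3 / 2)
    exact ⟨n, le_of_lt ((div_lt_iff₀ hpos).mp hn)⟩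
  have hall : ∀ k ≤ n, ‖(z : ℂ) ^ 2 ^ k - 1‖ < 1 / 2 := by
    intro k _
    have hmem : z ^ 2 ^ k ∈ H := H.pow_mem hz _
    simpa [Units.val_pow_eq_pow_val] using hH _ hmem
  have h1 := norm_pow_two_pow_sub_one_ge n hall
  have h2 := hall n le_rfl
  linarith

variable {G : Type*} [Group G] [TopologicalSpace G] [IsTopologicalGroup G] [CompactSpace G]
  [TotallyDisconnectedSpace G]

/-- A continuous character of a compact totally disconnected (profinite) group into `ℂˣ` kills an open normal
subgroup: the preimage of the ball `‖z − 1‖ < 1/2` is an open neighbourhood of `1`, it contains an open normal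
subgroup `N` (Mathlib), and `χ(N)` is a subgroup of `ℂˣ` inside the ball, hence trivial (`eq_bot_of_subset_ball`). -/
theorem exists_openNormalSubgroup_le_ker (χ : G →* ℂˣ) (hχ : Continuous χ) :
    ∃ N : OpenNormalSubgroup G, N.toSubgroup ≤ χ.ker := by
  let U : Set ℂˣ := {w | ‖(w : ℂ) - 1‖ < 1 / 2}
  have hU : IsOpen U := by
    have hc : Continuous fun w : ℂˣ => ‖(w : ℂ) - 1‖ :=
      (Units.continuous_val.sub continuous_const).norm
    exact isOpen_lt hc continuous_const
  have h1 : (1 : G) ∈ χ ⁻¹' U := by simp [U]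
  obtain ⟨N, hN⟩ :=
    ProfiniteGrp.exist_openNormalSubgroup_sub_open_nhds_of_one (hχ.isOpen_preimage U hU) h1
  refine ⟨N, ?_⟩
  have hmap : N.toSubgroup.map χ = ⊥ := by
    apply eq_bot_of_subset_ball
    rintro w ⟨g, hg, rfl⟩
    exact hN hg
  intro g hg
  rw [MonoidHom.mem_ker]
  have hg' : χ g ∈ N.toSubgroup.map χ := Subgroup.mem_map_of_mem χ hg
  rw [hmap] at hg'
  exact Subgroup.mem_bot.mp hg'

/-- **A continuous character of a profinite group into `ℂˣ` has finite range**: it factors through the finite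
quotient by an open normal subgroup it kills. -/
theorem finite_range_of_continuous (χ : G →* ℂˣ) (hχ : Continuous χ) : (Set.range χ).Finite := by
  obtain ⟨N, hN⟩ := exists_openNormalSubgroup_le_ker χ hχ
  let φ : G ⧸ N.toSubgroup →* ℂˣ := QuotientGroup.lift N.toSubgroup χ hN
  have hrange : Set.range χ = Set.range φ := by
    ext w
    constructor
    · rintro ⟨g, rfl⟩
      exact ⟨QuotientGroup.mk g, QuotientGroup.lift_mk N.toSubgroup hN g⟩
    · rintro ⟨q, rfl⟩
      obtain ⟨g, rfl⟩ := QuotientGroup.mk_surjective q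
      exact ⟨g, (QuotientGroup.lift_mk N.toSubgroup hN g).symm⟩
  rw [hrange]
  exact Set.finite_range φ

/-- The kernel of a continuous character of a profinite group into `ℂˣ` is open. -/
theorem isOpen_ker_of_continuous (χ : G →* ℂˣ) (hχ : Continuous χ) : IsOpen (χ.ker : Set G) := by
  obtain ⟨N, hN⟩ := exists_openNormalSubgroup_le_ker χ hχ
  exact Subgroup.isOpen_mono hN N.isOpen

/-- The kernel of a continuous character of a profinite group into `ℂˣ` has finite index. -/
theorem finiteIndex_ker_of_continuous (χ : G →* ℂˣ) (hχ : Continuous χ) : χ.ker.FiniteIndex :=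
  haveI : Finite (G ⧸ χ.ker) := Subgroup.quotient_finite_of_isOpen _ (isOpen_ker_of_continuous χ hχ)
  Subgroup.finiteIndex_of_finite_quotient

/-- **A continuous character of a profinite group into `ℂˣ` is of finite order**: `χ g ^ n = 1` for every `g`, with
`n = Nat.card χ.range > 0`. -/
theorem exists_pow_eq_one (χ : G →* ℂˣ) (hχ : Continuous χ) :
    ∃ n : ℕ, 0 < n ∧ ∀ g : G, χ g ^ n = 1 := by
  have hfin : (χ.range : Set ℂˣ).Finite := by
    rw [MonoidHom.coe_range]
    exact finite_range_of_continuous χ hχ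
  haveI : Finite χ.range := hfin.to_subtype
  haveI : Nonempty χ.range := ⟨1⟩
  refine ⟨Nat.card χ.range, Nat.card_pos, fun g => ?_⟩
  have h : (⟨χ g, MonoidHom.mem_range.mpr ⟨g, rfl⟩⟩ : χ.range) ^ Nat.card χ.range = 1 :=
    pow_card_eq_one'
  have h' := congrArg Subtype.val h
  simpa using h'

/-- Two continuous characters of a profinite group into `ℂˣ` differ by a character of finite order
(`Ξ`-twists in the route's vocabulary). -/
theorem exists_pow_mul_inv_eq_one (χ₁ χ₂ : G →* ℂˣ) (h₁ : Continuous χ₁) (h₂ : Continuous χ₂) :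
    ∃ n : ℕ, 0 < n ∧ ∀ g : G, (χ₁ g * (χ₂ g)⁻¹) ^ n = 1 := by
  have hc : Continuous (χ₁ * χ₂⁻¹ : G →* ℂˣ) := by
    change Continuous fun g => χ₁ g * (χ₂ g)⁻¹
    exact h₁.mul h₂.inv
  obtain ⟨n, hn, h⟩ := exists_pow_eq_one (χ₁ * χ₂⁻¹) hc
  exact ⟨n, hn, fun g => h g⟩

end T3.ProfiniteCharacter

end HodgeRepro
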